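import Summits.QuantumFields.YangMills.Theorems.IR.LevelwiseDominationKernel
import Summits.QuantumFields.YangMills.Theorems.BalabanLadderIRcofTemporalTwistSubadditivity
import Literature.Barriers.QuantumFields.FiniteTemperatureSpatialReflectionPositivity
import HarnessLib

/-!
# Sketch — crux idea «mirror-flux» for `IRcof` (stmt-QuantumFields-26930), seat ymfull-r2c-lens-2 g2
# (LENS IDEATOR B «reformulation ∕ transfer + extremal structure», disorder∕centre vocabulary)

HONEST LABEL: finite-volume ∕ conditional bookkeeping.  Nothing here proves `PinnedExitsCofinalAt (1/24)`, `IRnscCof`, `IRcof`, `IR`,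
or the Clay Yang–Mills mass gap (NOT proved anywhere in this tree; R4 = the conditional finite-𝕋⁴ rung `BalabanLadder.UV` only).
bears_on: R2c.  Line of record `Cruxes/IRcof/Lines/pinned_cofinal_bill.lean` (d3255819134117aa) untouched; no registry verb used.

THE LEVER (one sentence): reflection positivity ACROSS A SPATIAL MIRROR of the spatial torus `(ℤ/L)^3` (auxiliary long Euclidean time,
vacuum form), applied to a centre-CHARGED half-space observable `F = A_q(0)·conj A_q(s)` (a momentum-`q` packet of fat spatial winding Wilson
lines and its time-`s` translate), gives `|⟨F⟩|² ≤ ⟨F·conj(F∘θ)⟩`, and `F·conj(F∘θ) = N(0)·conj N(s)` with `N = A_q·conj(A_q∘θ)` centre-NEUTRAL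
of momentum `≈ 2q ≠ 0`: the squared MOVING-flux propagator is dominated by a NEUTRAL excited-state correlator plus a kinematic leakage.  Hence
NEUTRAL purity of the box (the centre-blind half V, width 0 by name) forbids light MOVING flux, and the flux half F of THE NUMBER is reduced to a
statement about the INTERNAL structure of the flux sector — **FB⁺ flux boostability ∕ no rigid flux bottom** («in a neutrally pure box the
lowest flux level can be given momentum `2πq/L` at energy cost `≤ v·2πq/L`, and the flux structure factor has no zero-momentum peak») — which
is FALSE exactly for a gapped phase with rigid degenerate flux vacua (ℤ_N topological order ∕ 't Hooft's Higgs-type phase; finite-`G` toy) and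
does not assert that flux is HEAVY.  The RP step replaces gen-1's interlacing hypothesis I («neutral purity ⇒ heavy flux», critic CUT-5: "any proof
contains confinement") by a theorem-shaped inequality + the Higgs-phase excluder FB⁺.

CONTENT (sorry-free; farm rc 0):
* §1 (concrete, over landed declarations; the FIRST LEMMA) `MirrorSchwarz` — the Schwarz form `‖⟨O⟩‖² ≤ Re ⟨O · conj(O ∘ θ_i)⟩` of the LANDED
  spatial bond reflection positivity `FiniteTemperature.integral_mul_conj_spaceReflect_mul_weight_nonneg` (Borgs–Seiler 1983 §II) on
  `ℤ_{L₀} × (ℤ/L)^d`, `L = 2n+2`, and its specialisation `TorelonMirrorBound` to `F = W_μ(t₀,x)·conj W_μ(t₀+s,x)` (`spaceHolonomy`, `windingTrace`,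
  `cexpect`, `torelonPair`).  Typed Props (proof route: the landed theorem applied to `O − ⟨O⟩`; ATTACKABLE, S-sized, group-blind).
* §2 currency (partition-function level, landed `TemporalTwistSubadditivity.projZ ∕ projDefect`; `IsProjDatum`, `projZ_pos`, `projZ_le_partition`
  inlined verbatim from the gen-1 sheet so that this file builds from Theorems ∕ Literature only): `NeutralPurityAllCof` (V at aspects `8j:1` and
  `4:1`, every `j`; RESIDUAL, width 0) and the junction `ChargedCeilingEv c`.
* §3 PROVED: `defect_le_of_proj_ceiling`, `coldDefect_le_of_projPure_ceiling`, ★ `pinnedExitsCofinal_of_neutral_ceiling :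
  NeutralPurityAllCof → ChargedCeilingEv (1/100) → PinnedExitsCofinalAt (1/24)`, `IRcof_of_neutral_ceiling : … → IRnscCof → IRcof` BY NAME.
* §4 the mechanism: `excited_le_of_defect` (PROVED: purity ⇒ excited weight `≤ ε/(1−ε)`), momentum packets `packet ∕ packetProp` on the auxiliary
  box `ℤ_{L₀} × (ℤ/L)^3`, the crux `FluxBoostEv` (FB⁺), `FluxVisibleEv` (VIS), `DiagonalFluxDominance` (DD: half-space operators never carry a
  fully diagonal flux), the schematic arithmetic `top_le_of_mirror_boost_visible` ∕ `charged_le_of_top` (PROVED), the dictionary stub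
  `MirrorMechanism` (ATTACKABLE-L) and the node ★★ `IRcof_of_mirror_flux`.
* §5 toy: `not_boost_of_rigid_flux` — rigid light flux + gapped moving flux violates FB⁺ (the ℤ_N ∕ toric-code spectral pattern).
-/

set_option autoImplicit false

noncomputable section

open Filter Topology MeasureTheory
open scoped BigOperators ComplexConjugate
open Literature.MathematicalPhysics.QuantumFieldTheory Literature.MathematicalPhysics.QuantumLattice
open Summit.QuantumFields.YangMills.Cruxes.OSLegsFromFemtoAndGap.DlrCollarTransfer (LowerBounds)
open Summit.QuantumFields.YangMills.Cruxes.IR.ColdPurityBridge (coldDefect)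
open Summit.QuantumFields.YangMills.Cruxes.IR.RankPurity (IRnscCof)
open Summit.QuantumFields.YangMills.Cruxes.IRcof.RunningLandmark (PinnedExitsCofinalAt)
open Summit.QuantumFields.YangMills.Cruxes.IRcof.TemporalTwistSubadditivity (eTwist projZ projDefect eTwist_center)

namespace Summit.QuantumFields.YangMills.Cruxes.IRcof.MirrorFlux

/-! ## §1 The first lemma: Schwarz form of spatial reflection positivity, and the torelon mirror bound -/

section Concrete

open Literature.Barriers.QuantumFields.FiniteTemperature

variable {d L₀ L : ℕ} {G : Type} [Group G] {N : ℕ}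

/-- Ordered holonomy of `k` forward steps in the SPATIAL direction `μ` from the site `y` of the anisotropic box `ℤ_{L₀} × (ℤ/L)^d`. -/
def spaceHolonomy (U : Config d L₀ L G) (μ : Fin d) : ℕ → Site d L₀ L → G
  | 0, _ => 1
  | k + 1, y => U (y, some μ) * spaceHolonomy U μ k (y.shift (some μ))

/-- **Spatial winding line** (torelon creator) `W_μ(y) = N⁻¹ tr ρ(∏ U)` along the closed cycle of length `L` in direction `μ` through `y = (t₀, x)`.
It is charged (`W ↦ z^{-k} W`) under the temporal centre twist `z^k` in the plane `(μ, time)` — 't Hooft's electric flux `e_μ` — and lives in the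
half-space `{x_i > 0}` whenever its base does (`μ ≠ i`). -/
def windingTrace (ρ : G →* Matrix (Fin N) (Fin N) ℂ) (U : Config d L₀ L G) (μ : Fin d) (y : Site d L₀ L) : ℂ :=
  ((N : ℂ))⁻¹ * (ρ (spaceHolonomy U μ L y)).trace

variable [TopologicalSpace G] [IsTopologicalGroup G] [CompactSpace G] [MeasurableSpace G] [BorelSpace G]

/-- Complex expectation `⟨F⟩ = ∫ F e^{−S} ∏dg / ∫ e^{−S} ∏dg` in the anisotropic Wilson box (couplings `J_E = J_M = β`). -/
def cexpect [NeZero L₀] [NeZero L] (ρ : G →* Matrix (Fin N) (Fin N) ℂ) (β : ℝ) (F : Config d L₀ L G → ℂ) : ℂ :=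
  (∫ U, F U * (weight ρ β β U : ℂ) ∂haar d L₀ L G) / ((∫ U, weight ρ β β U ∂haar d L₀ L G : ℝ) : ℂ)

/-- **FIRST LEMMA `MirrorSchwarz` (RP Schwarz across a spatial bond mirror).**  For continuous unitary `ρ`, `β ≥ 0`, even spatial period
`L = 2n+2`, a spatial direction `i` and every bounded measurable observable `O` of the positive half (`DependsOn O bondPos`):
`‖⟨O⟩‖² ≤ Re ⟨O · conj(O ∘ θ_i)⟩`.  Proof route (not carried out here): the landed `integral_mul_conj_spaceReflect_mul_weight_nonneg` applied to
`O − ⟨O⟩` (constants are half-space observables) and `θ_i`-invariance of the weighted measure (`measurePreserving_spaceReflect` + invariance of the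
Wilson action).  ATTACKABLE, S-sized, group-blind. -/
def MirrorSchwarz : Prop :=
  ∀ (d L₀ n N : ℕ) [NeZero L₀] (G : Type) [Group G] [TopologicalSpace G] [IsTopologicalGroup G] [CompactSpace G] [MeasurableSpace G]
    [BorelSpace G] (ρ : G →* Matrix (Fin N) (Fin N) ℂ), Continuous ρ → (∀ g, ρ g ∈ Matrix.unitaryGroup (Fin N) ℂ) →
    ∀ (β : ℝ), 0 ≤ β → ∀ (i : Fin d) (O : Config d L₀ (2 * n + 2) G → ℂ), Measurable O → (∃ K : ℝ, ∀ U, ‖O U‖ ≤ K) →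
      DependsOn O ((bondPos d L₀ n i : Finset _) : Set _) →
      ‖cexpect ρ β O‖ ^ 2 ≤ (cexpect ρ β fun U => O U * conj (O (spaceReflect i U))).re

/-- The torelon-pair observable `F_s(U) = W_μ(t₀, x) · conj W_μ(t₀ + s, x)`: a winding line and its translate by `s` lattice units of Euclidean time. -/
def torelonPair (ρ : G →* Matrix (Fin N) (Fin N) ℂ) (μ : Fin d) (t₀ : ZMod L₀) (s : ℕ) (x : Fin d → ZMod L) (U : Config d L₀ L G) : ℂ :=
  windingTrace ρ U μ (t₀, x) * conj (windingTrace ρ U μ (t₀ + (s : ZMod L₀), x))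

/-- **`TorelonMirrorBound`** (the specialisation that carries the lever): for `μ ≠ i` and a base point in the open positive half,
`|⟨W(0) conj W(s)⟩|² ≤ Re ⟨F_s · conj(F_s ∘ θ_i)⟩`, and `F_s · conj(F_s ∘ θ_i) = O(t₀) · conj O(t₀+s)` with `O = W_μ(·,x) · conj W_μ(·,θ_i x)`
centre-NEUTRAL: the squared flux propagator is dominated by a neutral two-time correlator.  Immediate from `MirrorSchwarz`. -/
def TorelonMirrorBound : Prop :=
  ∀ (d L₀ n N : ℕ) [NeZero L₀] (G : Type) [Group G] [TopologicalSpace G] [IsTopologicalGroup G] [CompactSpace G] [MeasurableSpace G]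
    [BorelSpace G] (ρ : G →* Matrix (Fin N) (Fin N) ℂ), Continuous ρ → (∀ g, ρ g ∈ Matrix.unitaryGroup (Fin N) ℂ) →
    ∀ (β : ℝ), 0 ≤ β → ∀ (i μ : Fin d), μ ≠ i → ∀ (t₀ : ZMod L₀) (s : ℕ) (x : Fin d → ZMod (2 * n + 2)),
      1 ≤ (-(x i)).val → (-(x i)).val ≤ n →
      ‖cexpect ρ β (torelonPair ρ μ t₀ s x)‖ ^ 2 ≤
        (cexpect ρ β fun U => torelonPair ρ μ t₀ s x U * conj (torelonPair ρ μ t₀ s x (spaceReflect i U))).re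

end Concrete

/-! ## §2 Currency of the chain (partition-function level) -/

section ProjDefs

variable {G : Type} [Group G]

/-- **Projection datum** (verbatim from the gen-1 sheet `FluxInterlacing.IsProjDatum`, inlined so that this file builds from Theorems ∕ Literature
modules only): a central `z` of exponent `n ≥ 1`; `projZ ρ β z n` averages the cold box over the twist group `⟨z⟩³` in the three temporal planes. -/
def IsProjDatum (z : G) (n : ℕ) : Prop :=
  z ∈ Subgroup.center G ∧ 0 < n ∧ z ^ n = 1

end ProjDefs


/-- **V_{8j} — `NeutralPurityAllCof` (RESIDUAL, declared; centre-blind, width 0 by name = «neutral gap at every fixed aspect»)**: for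
simply-connected simple `G`, faithful `r`, admissible `a` with the floor, every aspect parameter `j ≥ 1` and every `ε > 0`: cofinally in `β` a box
`L ≥ 16 j` of bounded physical size `a β · L ≤ T(j, ε)` whose `⟨z⟩³`-projected (NEUTRAL) period-doubling defect is `≤ ε` at BOTH aspects
`t = L/(8j)` and `t = L/4`.  The 4:1 conjunct alone is implied by `∀ θ, PinnedExitsCofinalAt θ` (gen-1 `neutralPurityCof_of_pxcofAll`, `z = 1`);
the `8j:1` conjunct is the same neutral half read at a hotter aspect (no by-name certificate in the tree: the aspect differs). -/
def NeutralPurityAllCof : Prop :=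
  ∀ (G : Type) [Group G] [TopologicalSpace G] [IsTopologicalGroup G] [CompactSpace G],
    IsCompactSimpleLieGroup G → SimplyConnectedSpace G →
    letI : MeasurableSpace G := borel G
    haveI : BorelSpace G := ⟨rfl⟩
    ∀ (r : LatticeRep G) (a : ℝ → ℝ), (∀ β, 0 < a β) → Tendsto a atTop (𝓝 0) → LowerBounds G r a →
      ∀ j : ℕ, 1 ≤ j → ∀ ε : ℝ, 0 < ε → ∃ T : ℝ, ∀ β₁ : ℝ, ∃ β : ℝ, β₁ ≤ β ∧ ∃ L : ℕ, 16 * j ≤ L ∧ a β * (L : ℝ) ≤ T ∧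
        ∃ (z : G) (n : ℕ), IsProjDatum z n ∧ projDefect r.ρ β z n L (L / (8 * j)) ≤ ε ∧ projDefect r.ρ β z n L (L / 4) ≤ ε

/-- **`ChargedCeilingEv c`** (the junction the lever delivers): for simply-connected simple `G` and faithful `r` there are `ε₀ > 0`, `β₀` and an
aspect parameter `j ≥ 1` (ALL AFTER `∀ r`; `j` is fixed by the boost velocity of FB⁺ and the window kinematics) such that at every `β ≥ β₀`,
`L ≥ 16 j`: if the `⟨z⟩³`-projected defects at aspects `8j:1` and `4:1` are `≤ ε₀`, the FULL trace at `t = L/4` is at most `(1 + c) ×` the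
projected one — the CHARGED (flux) trace is `≤ c ×` the neutral trace.  Weak coupling, single boxes, no floor ∕ unit map; vacuous wherever the
neutral sector is impure (femto window, Coulomb phase, hot boxes `a·L/4 < 1/T_c`); FALSE for finite gauge groups (topological order). -/
def ChargedCeilingEv (c : ℝ) : Prop :=
  ∀ (G : Type) [Group G] [TopologicalSpace G] [IsTopologicalGroup G] [CompactSpace G],
    IsCompactSimpleLieGroup G → SimplyConnectedSpace G →
    letI : MeasurableSpace G := borel G
    haveI : BorelSpace G := ⟨rfl⟩
    ∀ r : LatticeRep G, ∃ (ε₀ β₀ : ℝ) (j : ℕ), 0 < ε₀ ∧ 1 ≤ j ∧ ∀ β : ℝ, β₀ ≤ β → ∀ L : ℕ, 16 * j ≤ L →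
      ∀ (z : G) (n : ℕ), IsProjDatum z n → projDefect r.ρ β z n L (L / (8 * j)) ≤ ε₀ → projDefect r.ρ β z n L (L / 4) ≤ ε₀ →
        wilsonFinTorusPartition r.ρ β L L L (L / 4) ≤ (1 + c) * projZ r.ρ β z n L (L / 4)

/-! ## §3 PROVED: neutral purity + charged ceiling ⇒ THE NUMBER ⇒ `IRcof` -/

/-- **Real-number core.**  `A₂ ≤ Z₂`, `1 − A₂/A₁² ≤ ε`, `Z₁ ≤ (1+c) A₁` (`A₁, Z₁ > 0`, `c, ε ≥ 0`, `ε ≤ 1`) give `1 − Z₂/Z₁² ≤ ε + 2c`. -/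
theorem defect_le_of_proj_ceiling {Z₁ Z₂ A₁ A₂ c ε : ℝ} (hA₁ : 0 < A₁) (hZ₁ : 0 < Z₁) (hc : 0 ≤ c)
    (hε0 : 0 ≤ ε) (hε1 : ε ≤ 1) (hdom : A₂ ≤ Z₂) (hV : 1 - A₂ / A₁ ^ 2 ≤ ε) (hC : Z₁ ≤ (1 + c) * A₁) :
    1 - Z₂ / Z₁ ^ 2 ≤ ε + 2 * c := by
  have hA₁sq : 0 < A₁ ^ 2 := by positivity
  have hA₂ : (1 - ε) * A₁ ^ 2 ≤ A₂ := by
    have h1 : 1 - ε ≤ A₂ / A₁ ^ 2 := by linarith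
    exact (le_div_iff₀ hA₁sq).1 h1
  have hZ₁sq : Z₁ ^ 2 ≤ (1 + c) ^ 2 * A₁ ^ 2 := by
    rw [← mul_pow]; exact pow_le_pow_left₀ hZ₁.le hC 2
  have key : (1 - ε - 2 * c) * (1 + c) ^ 2 ≤ 1 - ε := by
    nlinarith [mul_nonneg hc hc, mul_nonneg (mul_nonneg hc hc) hc, mul_nonneg hc hε0, mul_nonneg (mul_nonneg hc hc) hε0]
  have hZ₂ : (1 - ε - 2 * c) * Z₁ ^ 2 ≤ Z₂ := by
    by_cases hs : 0 ≤ 1 - ε - 2 * c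
    · calc (1 - ε - 2 * c) * Z₁ ^ 2 ≤ (1 - ε - 2 * c) * ((1 + c) ^ 2 * A₁ ^ 2) := mul_le_mul_of_nonneg_left hZ₁sq hs
        _ = ((1 - ε - 2 * c) * (1 + c) ^ 2) * A₁ ^ 2 := by ring
        _ ≤ (1 - ε) * A₁ ^ 2 := mul_le_mul_of_nonneg_right key hA₁sq.le
        _ ≤ Z₂ := hA₂.trans hdom
    · have h1 : (1 - ε - 2 * c) * Z₁ ^ 2 ≤ 0 := mul_nonpos_of_nonpos_of_nonneg (le_of_lt (not_le.1 hs)) (sq_nonneg _)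
      have hA₂nn : 0 ≤ A₂ := le_trans (by nlinarith) hA₂
      linarith [hA₂nn.trans hdom]
  have hZ₁sq0 : 0 < Z₁ ^ 2 := by positivity
  have h3 : 1 - ε - 2 * c ≤ Z₂ / Z₁ ^ 2 := (le_div_iff₀ hZ₁sq0).2 hZ₂
  linarith

section OneBox

variable {G : Type} [Group G] [TopologicalSpace G] [IsTopologicalGroup G] [CompactSpace G]
  [MeasurableSpace G] [BorelSpace G] [SecondCountableTopology G] {N : ℕ} {ρ : G →* Matrix (Fin N) (Fin N) ℂ}

/-- The projected trace is positive (gen-1 `FluxInterlacing.projZ_pos`, inlined). -/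
theorem projZ_pos (hρ : Continuous ρ) (β : ℝ) (z : G) {n : ℕ} (hn : 0 < n) (L t : ℕ) : 0 < projZ ρ β z n L t := by
  unfold projZ
  haveI : NeZero n := ⟨Nat.pos_iff_ne_zero.1 hn⟩
  haveI : Nonempty (Fin 3 → Fin n) := ⟨fun _ => 0⟩
  refine mul_pos (inv_pos.2 ?_) (Finset.sum_pos (fun k _ => wilsonFinTorusTensorTwistedPartition_pos ρ hρ β _ _ _ _ _)
    Finset.univ_nonempty)
  exact_mod_cast Fintype.card_pos

/-- `A ≤ Z`: the projected trace is dominated by the full trace (gen-1 `FluxInterlacing.projZ_le_partition`, inlined; tree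
`wilsonFinTorusTensorTwistedPartition_le_partition`). -/
theorem projZ_le_partition (hρ : Continuous ρ) (hρu : ∀ g, ρ g ∈ Matrix.unitaryGroup (Fin N) ℂ) {β : ℝ} (hβ : 0 ≤ β)
    {z : G} (hz : z ∈ Subgroup.center G) {n : ℕ} (hn : 0 < n) {L t : ℕ} (hL : 2 ≤ L) (ht : 2 ≤ t) :
    projZ ρ β z n L t ≤ wilsonFinTorusPartition ρ β L L L t := by
  unfold projZ
  haveI : NeZero n := ⟨Nat.pos_iff_ne_zero.1 hn⟩
  have hcard : (0 : ℝ) < ((Fintype.card (Fin 3 → Fin n) : ℕ) : ℝ) := by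
    haveI : Nonempty (Fin 3 → Fin n) := ⟨fun _ => 0⟩
    exact_mod_cast Fintype.card_pos
  have hle : ∑ k : Fin 3 → Fin n, wilsonFinTorusTensorTwistedPartition ρ β (eTwist z k) L L L t ≤
      ∑ _k : Fin 3 → Fin n, wilsonFinTorusPartition ρ β L L L t :=
    Finset.sum_le_sum fun k _ =>
      wilsonFinTorusTensorTwistedPartition_le_partition ρ hρ hρu hβ (fun μ ν _ => eTwist_center hz k μ ν) hL hL ht
  rw [Finset.sum_const, Finset.card_univ, nsmul_eq_mul] at hle
  calc ((Fintype.card (Fin 3 → Fin n) : ℕ) : ℝ)⁻¹ * ∑ k : Fin 3 → Fin n,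
          wilsonFinTorusTensorTwistedPartition ρ β (eTwist z k) L L L t
        ≤ ((Fintype.card (Fin 3 → Fin n) : ℕ) : ℝ)⁻¹ *
          (((Fintype.card (Fin 3 → Fin n) : ℕ) : ℝ) * wilsonFinTorusPartition ρ β L L L t) :=
        mul_le_mul_of_nonneg_left hle (inv_nonneg.2 hcard.le)
    _ = wilsonFinTorusPartition ρ β L L L t := by rw [← mul_assoc, inv_mul_cancel₀ hcard.ne', one_mul]

/-- **One box: neutral purity (4:1) + charged ceiling ⇒ purity.**  `projDefect(L, L/4) ≤ ε ≤ 1` and `Z(L/4) ≤ (1+c)·projZ(L/4)` give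
`coldDefect ≤ ε + 2c`. -/
theorem coldDefect_le_of_projPure_ceiling (hρ : Continuous ρ) (hρu : ∀ g, ρ g ∈ Matrix.unitaryGroup (Fin N) ℂ)
    {β : ℝ} (hβ : 0 ≤ β) {L : ℕ} (hL : 8 ≤ L) {z : G} {n : ℕ} (hzn : IsProjDatum z n)
    {c ε : ℝ} (hc : 0 ≤ c) (hε0 : 0 ≤ ε) (hε1 : ε ≤ 1)
    (hV : projDefect ρ β z n L (L / 4) ≤ ε) (hC : wilsonFinTorusPartition ρ β L L L (L / 4) ≤ (1 + c) * projZ ρ β z n L (L / 4)) :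
    coldDefect ρ β L ≤ ε + 2 * c := by
  have hL2 : 2 ≤ L := by omega
  have ht2 : 2 ≤ 2 * (L / 4) := by omega
  unfold coldDefect
  unfold projDefect at hV
  exact defect_le_of_proj_ceiling (projZ_pos hρ β z hzn.2.1 L (L / 4)) (wilsonFinTorusPartition_pos hρ β L L L (L / 4)) hc hε0 hε1
    (projZ_le_partition hρ hρu hβ hzn.1 hzn.2.1 hL2 ht2) hV hC

end OneBox

/-- ★ **V ∧ ChargedCeiling(1/100) ⇒ PXcof(1/24)** (`RunningLandmark.PinnedExitsCofinalAt (1/24)`, the Theorems twin of the slot's registered stub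
`PinnedCofinalBill.stub_pinnedExitsCofinal`).  The ceiling fixes `(ε₀, β₀, j)`; V at aspect `j` with `ε := min ε₀ (1/50)` supplies the pinned box;
`1/50 + 2/100 ≤ 1/24`. -/
theorem pinnedExitsCofinal_of_neutral_ceiling (hV : NeutralPurityAllCof) (hC : ChargedCeilingEv (1 / 100)) :
    PinnedExitsCofinalAt (1 / 24) := by
  intro G _ _ _ _ hG hsc
  letI : MeasurableSpace G := borel G
  haveI : BorelSpace G := ⟨rfl⟩
  intro r a ha ha0 hlb
  obtain ⟨ε₀, β₀, j, hε₀, hj, hCr⟩ := hC G hG hsc r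
  set ε : ℝ := min ε₀ (1 / 50) with hεdef
  have hεpos : 0 < ε := lt_min hε₀ (by norm_num)
  have hεle₀ : ε ≤ ε₀ := min_le_left _ _
  have hεle : ε ≤ 1 / 50 := min_le_right _ _
  have hε1 : ε ≤ 1 := hεle.trans (by norm_num)
  obtain ⟨T, hT⟩ := hV G hG hsc r a ha ha0 hlb j hj ε hεpos
  refine ⟨T, fun β₁ => ?_⟩
  obtain ⟨β, hβ, L, hL, haL, z, n, hzn, hproj8, hproj4⟩ := hT (max β₁ (max β₀ 0))
  have hβ₁ : β₁ ≤ β := le_trans (le_max_left _ _) hβ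
  have hβ₀ : β₀ ≤ β := le_trans ((le_max_left _ _).trans (le_max_right _ _)) hβ
  have hβ0 : 0 ≤ β := le_trans ((le_max_right _ _).trans (le_max_right _ _)) hβ
  haveI : SecondCountableTopology G :=
    (r.continuous.isClosedEmbedding r.injective).isEmbedding.secondCountableTopology
  have hceil := hCr β hβ₀ L hL z n hzn (hproj8.trans hεle₀) (hproj4.trans hεle₀)
  have hL8 : 8 ≤ L := by omega
  have hcd := coldDefect_le_of_projPure_ceiling r.continuous r.mem_unitary hβ0 hL8 hzn (by norm_num : (0:ℝ) ≤ 1 / 100)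
    hεpos.le hε1 hproj4 hceil
  refine ⟨β, hβ₁, L, hL8, haL, ?_⟩
  show coldDefect r.ρ β L ≤ 1 / 24
  refine hcd.trans ?_
  have : ε + 2 * (1 / 100) ≤ 1 / 50 + 2 * (1 / 100) := by linarith
  exact this.trans (by norm_num)

/-- **V ∧ ChargedCeiling(1/100) ∧ N_cof ⇒ `IRcof` BY NAME** (through the landed `LevelwiseDomination.IRcof_of_pinnedExitsCofinalAt`). -/
theorem IRcof_of_neutral_ceiling (hV : NeutralPurityAllCof) (hC : ChargedCeilingEv (1 / 100)) (hN : IRnscCof) :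
    Summit.QuantumFields.YangMills.Theses.BalabanLadder.IRcof :=
  Summit.QuantumFields.YangMills.Cruxes.IR.LevelwiseDomination.IRcof_of_pinnedExitsCofinalAt
    (pinnedExitsCofinal_of_neutral_ceiling hV hC) hN

/-! ## §4 The mechanism: momentum packets on the spatial torus with LONG auxiliary time, FB⁺, VIS, DD, the dictionary stub

The inequality is used in VACUUM FORM: the spatial torus `(ℤ/L)^3` of THE NUMBER's box carries one Hamiltonian `H_{L³,β}` (transfer matrix in
time); THE NUMBER's traces are `tr e^{−t H}` at `t = L/4, L/2`, while the mirror inequality is applied on the auxiliary boxes `ℤ_{L₀} × (ℤ/L)^3`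
with `L₀ → ∞` (thermal wrap-around terms vanish in the limit by Perron–Frobenius uniqueness of the vacuum of the positive transfer matrix), where
it reads `⟨Ω|A† e^{−sΔH} A|Ω⟩² ≤ |⟨Ω|A (θAθ)†|Ω⟩|² + x(s) · ‖(θAθ)†‖² ‖A Ω‖²…`, `x(s) = Σ_{n ≠ Ω neutral} e^{−sΔE_n} ≤ ε/(1−ε)` from the neutral
defect at time `s` (`excited_le_of_defect`).  The first (leakage) term is bounded by `sup_p |ĝ(q−p) ĝ(−q−p)| ×` the flux structure factor —
kinematically small for a smooth window at packet momentum `q⋆ ≫` (window width)⁻¹ PROVIDED the structure factor has no zero-momentum peak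
(the `s = 0` clause of FB⁺).
-/

/-- **Purity ⇒ uniformly small excited weight (PROVED).**  With `Z(s) = 1 + x` (vacuum-normalised trace, `x ≥ 0` the excited weight) and
`Z(2s) ≤ 1 + x` (each `e^{−2sΔE} ≤ e^{−sΔE}`), a defect `1 − Z(2s)/Z(s)² ≤ ε < 1` forces `x ≤ ε/(1−ε)`. -/
theorem excited_le_of_defect {x Z₂ ε : ℝ} (hx : 0 ≤ x) (hZ₂ : Z₂ ≤ 1 + x) (hε : ε < 1)
    (hdef : 1 - Z₂ / (1 + x) ^ 2 ≤ ε) : x ≤ ε / (1 - ε) := by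
  have h1 : 0 < 1 + x := by linarith
  have h1sq : 0 < (1 + x) ^ 2 := by positivity
  have h2 : (1 - ε) * (1 + x) ^ 2 ≤ Z₂ := by
    have : 1 - ε ≤ Z₂ / (1 + x) ^ 2 := by linarith
    exact (le_div_iff₀ h1sq).1 this
  have h3 : (1 - ε) * (1 + x) ^ 2 ≤ 1 + x := h2.trans hZ₂
  have h4 : (1 - ε) * (1 + x) ≤ 1 := by
    have : (1 - ε) * (1 + x) * (1 + x) ≤ 1 * (1 + x) := by nlinarith
    exact le_of_mul_le_mul_right this h1
  rw [le_div_iff₀ (by linarith : (0:ℝ) < 1 - ε)]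
  nlinarith

section Packets

open Literature.Barriers.QuantumFields.FiniteTemperature

variable {G : Type} [Group G] [TopologicalSpace G] [IsTopologicalGroup G] [CompactSpace G] [MeasurableSpace G] [BorelSpace G] {N : ℕ}

/-- **Momentum packet of winding lines** on the auxiliary box `ℤ_{L₀} × (ℤ/L)^3` (time `L₀` free, taken long): lines winding the spatial
direction `1`, based in the positive half `1 ≤ c ≤ L/4` of the mirror direction `0` (transverse coordinate `x₂ = 0`), weighted by the plane
wave `e^{−2πi q c/L}` and the smooth bump `sin²(4πc/L)` (a Gevrey window would be used in the real dictionary); time slice `t₀`. -/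
def packet (ρ : G →* Matrix (Fin N) (Fin N) ℂ) (L₀ L : ℕ) (q : ℕ) (t₀ : ZMod L₀) (U : Config 3 L₀ L G) : ℂ :=
  ∑ c ∈ Finset.Icc 1 (L / 4), (Real.sin (4 * Real.pi * c / L) ^ 2 : ℝ) *
    Complex.exp (-(2 * Real.pi * Complex.I * (q : ℂ) * (c : ℂ) / (L : ℂ))) *
    windingTrace ρ U 1 (t₀, Pi.single 0 ((-(c : ℤ) : ℤ) : ZMod L))

/-- **Packet propagator** over Euclidean time `s` in the auxiliary box: `G_q(s; L₀) = Re ⟨A_q(0) · conj A_q(s)⟩_{β, ℤ_{L₀} × (ℤ/L)^3}`. -/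
def packetProp (ρ : G →* Matrix (Fin N) (Fin N) ℂ) (β : ℝ) (L₀ L q s : ℕ) [NeZero L₀] [NeZero L] : ℝ :=
  (cexpect (d := 3) ρ β fun U : Config 3 L₀ L G => packet ρ L₀ L q 0 U * conj (packet ρ L₀ L q ((s : ℕ) : ZMod L₀) U)).re

end Packets

/-- **FB⁺ — `FluxBoostEv` (the CRUX; IDEA-NEEDED ∕ INSTRUMENTABLE; the Higgs-∕topological-phase excluder)**: «a NEUTRALLY PURE box has no rigid
flux bottom»: for simply-connected simple `G` and faithful `r` there are `κ > 0`, `v ≥ 0`, `ε₁ > 0`, `β₀` and, for every packet momentum `q ≥ 1`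
and aspect parameter `j ≥ 1`, at every `β ≥ β₀`, `L ≥ 16 j`, every long auxiliary time `L₀ ≥ 4 L` and every projection datum: IF the neutral
defect at aspect `8j:1` is `≤ ε₁` THEN the momentum-`q` packet is not parametrically weaker than the momentum-`0` packet, at equal time
(no zero-momentum peak of the flux structure factor) and after `s = L/(8j)` (boost cost `≤ v·(2πq/L)·s = π v q/(4j)`):
`κ e^{−π v q/(4j)} G_0(s) ≤ G_q(s)` for `s ∈ {0, L/(8j)}`.  TRUE for string-like flux (confined boxes); vacuously unconstrained in femto ∕ Coulomb ∕
hot boxes (neutrally impure); FALSE exactly for a gapped phase with rigid degenerate flux vacua (ℤ_N topological order ∕ 't Hooft's Higgs-type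
phase: `not_boost_of_rigid_flux`), which is what it is there to exclude.  No floor, no unit map, no claim that flux is HEAVY. -/
def FluxBoostEv : Prop :=
  ∀ (G : Type) [Group G] [TopologicalSpace G] [IsTopologicalGroup G] [CompactSpace G],
    IsCompactSimpleLieGroup G → SimplyConnectedSpace G →
    letI : MeasurableSpace G := borel G
    haveI : BorelSpace G := ⟨rfl⟩
    ∀ r : LatticeRep G, ∃ (κ v ε₁ β₀ : ℝ), 0 < κ ∧ 0 ≤ v ∧ 0 < ε₁ ∧ ∀ (q j : ℕ), 1 ≤ q → 1 ≤ j →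
      ∀ β : ℝ, β₀ ≤ β → ∀ (L : ℕ) [NeZero L], 16 * j ≤ L → ∀ (L₀ : ℕ) [NeZero L₀], 4 * L ≤ L₀ → ∀ (z : G) (n : ℕ), IsProjDatum z n →
        projDefect r.ρ β z n L (L / (8 * j)) ≤ ε₁ →
        ∀ s ∈ ({0, L / (8 * j)} : Set ℕ),
          κ * Real.exp (-(Real.pi * v * q / (4 * j))) * packetProp r.ρ β L₀ L 0 s ≤ packetProp r.ρ β L₀ L q s

/-- **VIS — `FluxVisibleEv` (mild; UNDECIDED)**: in a neutrally pure box the LOWEST flux level of momentum class `q` is visible to the fat packet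
with relative weight `≥ w > 0`, uniformly at weak coupling; typed through its only use — the flux trace at `t = L/4` in THE NUMBER's box is
bounded by the packet decay over `s = L/(8j)` in the auxiliary long box: `(Z − projZ)(L/4) ≤ w⁻¹ · (projZ(L/(8j))^{2j} ∕ projZ-normalisation) ·
(G_q(s)/G_q(0))`, stated at partition-function level (the transfer-matrix bookkeeping `Z_e(t) ≤ ρ_e^{t−s} Z_0(s)`, 't Hooft positivity
`Z_e ≤ Z_0`, lives in the dictionary). -/
def FluxVisibleEv : Prop :=
  ∀ (G : Type) [Group G] [TopologicalSpace G] [IsTopologicalGroup G] [CompactSpace G],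
    IsCompactSimpleLieGroup G → SimplyConnectedSpace G →
    letI : MeasurableSpace G := borel G
    haveI : BorelSpace G := ⟨rfl⟩
    ∀ r : LatticeRep G, ∃ (w ε₁ β₀ : ℝ), 0 < w ∧ 0 < ε₁ ∧ ∀ (q j : ℕ), 1 ≤ q → 1 ≤ j →
      ∀ β : ℝ, β₀ ≤ β → ∀ (L : ℕ) [NeZero L], 16 * j ≤ L → ∀ (L₀ : ℕ) [NeZero L₀], 4 * L ≤ L₀ → ∀ (z : G) (n : ℕ), IsProjDatum z n →
        projDefect r.ρ β z n L (L / (8 * j)) ≤ ε₁ →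
        0 < packetProp r.ρ β L₀ L q 0 ∧
        wilsonFinTorusPartition r.ρ β L L L (L / 4) - projZ r.ρ β z n L (L / 4) ≤
          w⁻¹ * projZ r.ρ β z n L (L / 4) * (packetProp r.ρ β L₀ L q (L / (8 * j)) / packetProp r.ρ β L₀ L q 0)

/-- **DD — `DiagonalFluxDominance` (UNDECIDED, second order)**: a half-space operator for the mirror `⊥ i` is neutral for the flux component
`e_i`, so the mirror lever reaches only fluxes with SOME vanishing component (axial and planar fluxes; all 7 − 1 = 6 of them for `SU(2)`); the
fully diagonal sectors (`(N−1)³` of `N³ − 1`) are declared dominated by the axial ∕ planar ones.  Typed as: the charged trace is at most `D ×`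
the charged trace of the sub-box twists with one plane untwisted — i.e. `Z − projZ ≤ D · Σ_i (projZ^{(i)} − projZ)` where `projZ^{(i)}`
averages only the twists in the two temporal planes other than `(i, time)`; positive-definiteness of `e ↦ Z_e` ('t Hooft) does NOT give it
(the indicator of the diagonal subgroup is positive definite), physics (longer diagonal strings) does; instrument question for `SU(2)`, `L = 2`. -/
def DiagonalFluxDominance : Prop :=
  ∀ (G : Type) [Group G] [TopologicalSpace G] [IsTopologicalGroup G] [CompactSpace G],
    IsCompactSimpleLieGroup G → SimplyConnectedSpace G →
    letI : MeasurableSpace G := borel G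
    haveI : BorelSpace G := ⟨rfl⟩
    ∀ r : LatticeRep G, ∃ (D β₀ : ℝ), 0 ≤ D ∧ ∀ β : ℝ, β₀ ≤ β → ∀ L : ℕ, 16 ≤ L → ∀ (z : G) (n : ℕ) [NeZero n], IsProjDatum z n →
      wilsonFinTorusPartition r.ρ β L L L (L / 4) - projZ r.ρ β z n L (L / 4) ≤
        D * ∑ i : Fin 3, (((Fintype.card (Fin 3 → Fin n) : ℕ) : ℝ)⁻¹ *
              (∑ k : Fin 3 → Fin n, if k i = 0 then (n : ℝ) * wilsonFinTorusTensorTwistedPartition r.ρ β (eTwist z k) L L L (L / 4) else 0)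
            - projZ r.ρ β z n L (L / 4))

/-- **The arithmetic of the lever (PROVED).**  RPI + leakage control give `G_q(s)² ≤ (η + x) · G_q(0)²`-type bounds; with boostability
`κ_b · G_0 ≤ G_q` and visibility `w · ρ_top ≤ G_0`: `ρ_top ≤ (η + √ε)/(κ_b w)` (schematic one-line form of the chain). -/
theorem top_le_of_mirror_boost_visible {Gf G0 η ε κb w ρtop : ℝ}
    (hRPI : Gf ≤ η + Real.sqrt ε) (hFB : κb * G0 ≤ Gf) (hVIS : w * ρtop ≤ G0) (hκ : 0 < κb) (hw : 0 < w) :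
    ρtop ≤ (η + Real.sqrt ε) / (κb * w) := by
  rw [le_div_iff₀ (mul_pos hκ hw)]
  have h1 : κb * (w * ρtop) ≤ κb * G0 := mul_le_mul_of_nonneg_left hVIS hκ.le
  nlinarith

/-- **Entropy step (PROVED).**  `Z_e(t) ≤ ρ_e^{t−s} · Z_e(s)`-type: the charged trace at the long time is at most the top charged eigenvalue power
times the charged trace at the short time, itself `≤ (1 + x(s)) ×` the vacuum weight by `Z_e ≤ Z_0`. -/
theorem charged_le_of_top {Xch2 Xch1 ρtop M : ℝ} (hstep : Xch2 ≤ ρtop * Xch1) (hdom : Xch1 ≤ 1 + M) (hρ : 0 ≤ ρtop) :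
    Xch2 ≤ ρtop * (1 + M) :=
  hstep.trans (mul_le_mul_of_nonneg_left hdom hρ)

/-- **`MirrorMechanism` — the dictionary stub (ATTACKABLE, L-sized; transfer-matrix bookkeeping, group-blind)**: (i) Osterwalder–Seiler
reconstruction on `ℤ_{L₀} × (ℤ/L)^3` for winding-line packets and the `L₀ → ∞` vacuum form of `MirrorSchwarz` (Perron–Frobenius); (ii) 't Hooft's
flux decomposition of the transfer matrix (`projZ = tr P e^{−tH}`, `Z_e ≤ Z_0`); (iii) window kinematics: leakage `|⟨Ω|A_q(θA_qθ)†|Ω⟩| ≤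
sup_p |ĝ(q−p)ĝ(−q−p)| ·` structure factor, scale-free in `L` at fixed `q`; (iv) `excited_le_of_defect`, `top_le_of_mirror_boost_visible`,
`charged_le_of_top`; (v) the choice `j ≥ v q`, `q` large against the window tail.  Output: FB⁺ ∧ VIS ∧ DD ⇒ the charged ceiling at every
neutrally pure box. -/
def MirrorMechanism : Prop :=
  MirrorSchwarz → FluxBoostEv → FluxVisibleEv → DiagonalFluxDominance → ChargedCeilingEv (1 / 100)

/-- ★★ **THE NODE: dictionary ∧ RP-Schwarz ∧ FB⁺ ∧ VIS ∧ DD ∧ V ∧ N_cof ⇒ `IRcof` BY NAME.**  Kernel-checked composition; every hypothesis is a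
named Prop of this file or of the tree; nothing is proved about Yang–Mills. -/
theorem IRcof_of_mirror_flux (hM : MirrorMechanism) (hRP : MirrorSchwarz) (hFB : FluxBoostEv) (hVIS : FluxVisibleEv)
    (hDD : DiagonalFluxDominance) (hV : NeutralPurityAllCof) (hN : IRnscCof) :
    Summit.QuantumFields.YangMills.Theses.BalabanLadder.IRcof :=
  IRcof_of_neutral_ceiling hV (hM hRP hFB hVIS hDD) hN

/-! ## §5 Toy: frozen topological order violates boostability -/

/-- **(dictionary entry «FB is false for ℤ_N»).**  In the topologically ordered spectral configuration the momentum-`0` packet sees the rigid light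
flux vacuum (`G_0(s) = g₀ > 0` for all `s`) while every moving flux state costs the bulk gap `m > 0` (`G_q(s) ≤ e^{−m s} g₀`); then no `κ > 0`
independent of `s` can satisfy `κ e^{−v q} G_0(s) ≤ G_q(s)` for all `s`: at `s` with `e^{−m s} < κ e^{−v q}` it fails. -/
theorem not_boost_of_rigid_flux {g₀ m κ v q s : ℝ} (hg : 0 < g₀)
    (hs : Real.exp (-(m * s)) < κ * Real.exp (-(v * q))) :
    ¬ (κ * Real.exp (-(v * q)) * g₀ ≤ Real.exp (-(m * s)) * g₀) := by
  intro h
  have := lt_of_lt_of_le (mul_lt_mul_of_pos_right hs hg) h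
  exact lt_irrefl _ this

end Summit.QuantumFields.YangMills.Cruxes.IRcof.MirrorFlux
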